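import Summits.ResolutionOfSingularities.ResolutionOfSingularities.Theorems.FrobeniusLadderFInjectiveMacaulayficationHypersurfaceRegular
import Mathlib.Algebra.MvPolynomial.PDeriv
import Mathlib.RingTheory.MvPolynomial.Basic
import Mathlib.Algebra.CharP.Two
import Mathlib.Tactic.LinearCombination
import HarnessLib

/-!
# The threefold `X₀²X₁ + X₁²X₂ + X₂²X₀ + X₀X₃³ + X₁X₂X₃²` in characteristic `2` is regular off the origin

Support file for crux stmt-ResolutionOfSingularities-15315 (`FrobeniusLadder.FInjectiveMacaulayfication`,
line `Sketch`): stub `stub_threefoldOffCentreRegular` of the THREEFOLD CALIBRATION (dimension `3`,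
characteristic `2`).

Let `k` be a field of characteristic `2`, `S = k[X₀, X₁, X₂, X₃]` and `R = S/(f)` with
`f = X₀²X₁ + X₁²X₂ + X₂²X₀ + X₀X₃³ + X₁X₂X₃²`. The germ `f` has an isolated singular point at the
origin; the blow-up glue E6′ needs, as its hypothesis `hoff`, that `R` is regular at every prime `P`
NOT containing the irrelevant point `𝔪 = (x̄₀, x̄₁, x̄₂, x̄₃)`. This file proves exactly that, by the
Jacobian criterion in its regular direction at an arbitrary prime (tree theorem
`HypersurfaceRegular.stub_hypersurfaceRegularOfPderiv`, Matsumura Thm. 30.4 (ii)).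

What is proved:

* `pderiv_zero_threefold`, …, `pderiv_three_threefold` — the four partial derivatives of `f` over any
  commutative ring: `∂₀f = 2X₀X₁ + X₂² + X₃³`, `∂₁f = X₀² + 2X₁X₂ + X₂X₃²`,
  `∂₂f = X₁² + 2X₂X₀ + X₁X₃²`, `∂₃f = 3X₀X₃² + 2X₁X₂X₃`.
* `stub_threefoldOffCentreRegular` — the registered form. In characteristic `2` the partials reduce to
  `∂₀f = X₂² + X₃³`, `∂₁f = X₀² + X₂X₃²`, `∂₂f = X₁² + X₁X₃²`, `∂₃f = X₀X₃²`. With `P₀ = P ∩ S`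
  (prime): if `X₃ ∈ P₀` and all of `∂₀f, ∂₁f, ∂₂f` lay in `P₀`, then successively `X₂² ∈ P₀`,
  `X₀² ∈ P₀`, `X₁² ∈ P₀`, so `X₀, X₁, X₂, X₃ ∈ P₀` and `𝔪 ≤ P` — excluded; hence one of them avoids
  `P₀` and the Jacobian criterion applies in that direction. If `X₃ ∉ P₀` and `X₀ ∉ P₀`, then
  `∂₃f = X₀X₃² ∉ P₀` (`P₀` prime). If `X₃ ∉ P₀` and `X₀ ∈ P₀`: should `∂₁f ∈ P₀`, then
  `X₂X₃² ∈ P₀`, so `X₂ ∈ P₀`, and then `∂₀f ∈ P₀` would give `X₃³ ∈ P₀`, `X₃ ∈ P₀` — excluded; so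
  `∂₁f ∉ P₀` or `∂₀f ∉ P₀`, and again the Jacobian criterion applies.

References: H. Matsumura, *Commutative Ring Theory*, Cambridge Stud. Adv. Math. 8, CUP 1986,
Thm. 30.4 (ii) [Matsumura1987] (through the imported Jacobian criterion). The computation itself is
folklore.
-/

-- single-problem summit: the doubled namespace component is forced
set_option linter.dupNamespace false

noncomputable section

namespace Summit.ResolutionOfSingularities.ResolutionOfSingularities.Theorems.FInjectiveMacaulayfication.ThreefoldOffCentreRegular

open MvPolynomial

/-- **`∂f/∂X₀ = 2X₀X₁ + X₂² + X₃³`** for `f = X₀²X₁ + X₁²X₂ + X₂²X₀ + X₀X₃³ + X₁X₂X₃²`, over any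
commutative ring (`MvPolynomial.pderiv_mul`, `pderiv_pow`, `pderiv_X_self`, `pderiv_X_of_ne`).
[folklore] -/
theorem pderiv_zero_threefold {A : Type*} [CommRing A] :
    pderiv 0 (X 0 ^ 2 * X 1 + X 1 ^ 2 * X 2 + X 2 ^ 2 * X 0 + X 0 * X 3 ^ 3 + X 1 * X 2 * X 3 ^ 2 :
      MvPolynomial (Fin 4) A) = 2 * (X 0 * X 1) + X 2 ^ 2 + X 3 ^ 3 := by
  simp only [map_add, pderiv_mul, pderiv_pow, pderiv_X_self,
    pderiv_X_of_ne (show (1 : Fin 4) ≠ 0 by decide), pderiv_X_of_ne (show (2 : Fin 4) ≠ 0 by decide),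
    pderiv_X_of_ne (show (3 : Fin 4) ≠ 0 by decide), Nat.reduceSub, pow_one, mul_one, mul_zero,
    add_zero, Nat.cast_ofNat]
  ring

/-- **`∂f/∂X₁ = X₀² + 2X₁X₂ + X₂X₃²`** for `f = X₀²X₁ + X₁²X₂ + X₂²X₀ + X₀X₃³ + X₁X₂X₃²`, over any
commutative ring (`MvPolynomial.pderiv_mul`, `pderiv_pow`, `pderiv_X_self`, `pderiv_X_of_ne`).
[folklore] -/
theorem pderiv_one_threefold {A : Type*} [CommRing A] :
    pderiv 1 (X 0 ^ 2 * X 1 + X 1 ^ 2 * X 2 + X 2 ^ 2 * X 0 + X 0 * X 3 ^ 3 + X 1 * X 2 * X 3 ^ 2 :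
      MvPolynomial (Fin 4) A) = X 0 ^ 2 + 2 * (X 1 * X 2) + X 2 * X 3 ^ 2 := by
  simp only [map_add, pderiv_mul, pderiv_pow, pderiv_X_self,
    pderiv_X_of_ne (show (0 : Fin 4) ≠ 1 by decide), pderiv_X_of_ne (show (2 : Fin 4) ≠ 1 by decide),
    pderiv_X_of_ne (show (3 : Fin 4) ≠ 1 by decide), Nat.reduceSub, pow_one, mul_one, mul_zero,
    zero_mul, add_zero, zero_add, Nat.cast_ofNat]
  ring

/-- **`∂f/∂X₂ = X₁² + 2X₂X₀ + X₁X₃²`** for `f = X₀²X₁ + X₁²X₂ + X₂²X₀ + X₀X₃³ + X₁X₂X₃²`, over any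
commutative ring (`MvPolynomial.pderiv_mul`, `pderiv_pow`, `pderiv_X_self`, `pderiv_X_of_ne`).
[folklore] -/
theorem pderiv_two_threefold {A : Type*} [CommRing A] :
    pderiv 2 (X 0 ^ 2 * X 1 + X 1 ^ 2 * X 2 + X 2 ^ 2 * X 0 + X 0 * X 3 ^ 3 + X 1 * X 2 * X 3 ^ 2 :
      MvPolynomial (Fin 4) A) = X 1 ^ 2 + 2 * (X 2 * X 0) + X 1 * X 3 ^ 2 := by
  simp only [map_add, pderiv_mul, pderiv_pow, pderiv_X_self,
    pderiv_X_of_ne (show (0 : Fin 4) ≠ 2 by decide), pderiv_X_of_ne (show (1 : Fin 4) ≠ 2 by decide),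
    pderiv_X_of_ne (show (3 : Fin 4) ≠ 2 by decide), Nat.reduceSub, pow_one, mul_one, mul_zero,
    zero_mul, add_zero, zero_add, Nat.cast_ofNat]
  ring

/-- **`∂f/∂X₃ = 3X₀X₃² + 2X₁X₂X₃`** for `f = X₀²X₁ + X₁²X₂ + X₂²X₀ + X₀X₃³ + X₁X₂X₃²`, over any
commutative ring (`MvPolynomial.pderiv_mul`, `pderiv_pow`, `pderiv_X_self`, `pderiv_X_of_ne`).
[folklore] -/
theorem pderiv_three_threefold {A : Type*} [CommRing A] :
    pderiv 3 (X 0 ^ 2 * X 1 + X 1 ^ 2 * X 2 + X 2 ^ 2 * X 0 + X 0 * X 3 ^ 3 + X 1 * X 2 * X 3 ^ 2 :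
      MvPolynomial (Fin 4) A) = 3 * (X 0 * X 3 ^ 2) + 2 * (X 1 * X 2 * X 3) := by
  simp only [map_add, pderiv_mul, pderiv_pow, pderiv_X_self,
    pderiv_X_of_ne (show (0 : Fin 4) ≠ 3 by decide), pderiv_X_of_ne (show (1 : Fin 4) ≠ 3 by decide),
    pderiv_X_of_ne (show (2 : Fin 4) ≠ 3 by decide), Nat.reduceSub, pow_one, mul_one, mul_zero,
    zero_mul, add_zero, zero_add, Nat.cast_ofNat]
  ring

/-- **The threefold `f = X₀²X₁ + X₁²X₂ + X₂²X₀ + X₀X₃³ + X₁X₂X₃²` in characteristic `2` is regular off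
the origin** (registered stub `stub_threefoldOffCentreRegular` of the threefold calibration): for a
field `k` of characteristic `2`, `R = k[X₀,…,X₃]/(f)`, and a prime `P` of `R` not containing
`𝔪 = (x̄₀, x̄₁, x̄₂, x̄₃)`, the local ring `R_P` is regular. Proof: let `P₀ = P ∩ k[X]`, a prime. In
characteristic `2`, `∂₀f = X₂² + X₃³`, `∂₁f = X₀² + X₂X₃²`, `∂₂f = X₁² + X₁X₃²`, `∂₃f = X₀X₃²`.
If `X₃ ∈ P₀`: were `∂₀f, ∂₁f, ∂₂f ∈ P₀`, then `X₂², X₀², X₁² ∈ P₀`, so all `Xⱼ ∈ P₀` and `𝔪 ≤ P`,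
excluded; so some `∂ᵢf ∉ P₀` (`i ≤ 2`) and the Jacobian criterion
(`HypersurfaceRegular.stub_hypersurfaceRegularOfPderiv`) applies. If `X₃ ∉ P₀` and `X₀ ∉ P₀`, then
`∂₃f = X₀X₃² ∉ P₀`. If `X₃ ∉ P₀`, `X₀ ∈ P₀`: `∂₁f ∈ P₀` forces `X₂X₃² ∈ P₀`, `X₂ ∈ P₀`, and then
`∂₀f ∈ P₀` would force `X₃³ ∈ P₀` — excluded; so `∂₁f ∉ P₀` or `∂₀f ∉ P₀`. [folklore] -/
theorem stub_threefoldOffCentreRegular : ∀ (k : Type) [Field k] [CharP k 2] (f : MvPolynomial (Fin 4) k),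
    f = MvPolynomial.X 0 ^ 2 * MvPolynomial.X 1 + MvPolynomial.X 1 ^ 2 * MvPolynomial.X 2 + MvPolynomial.X 2 ^ 2 * MvPolynomial.X 0 + MvPolynomial.X 0 * MvPolynomial.X 3 ^ 3 + MvPolynomial.X 1 * MvPolynomial.X 2 * MvPolynomial.X 3 ^ 2 →
    ∀ (P : Ideal (MvPolynomial (Fin 4) k ⧸ Ideal.span {f})) [P.IsPrime],
      ¬ Ideal.span (Set.range fun j : Fin 4 => Ideal.Quotient.mk (Ideal.span {f}) (MvPolynomial.X j)) ≤ P →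
      IsRegularLocalRing (Localization.AtPrime P) := by
  intro k _ _ f hf P _ hP
  -- `P₀ = P ∩ k[X]`, a prime ideal
  set P₀ : Ideal (MvPolynomial (Fin 4) k) := P.comap (Ideal.Quotient.mk (Ideal.span {f}))
  haveI hprime : P₀.IsPrime := Ideal.comap_isPrime _ _
  -- the Jacobian criterion in direction `i`
  have J : ∀ i : Fin 4, pderiv i f ∉ P₀ → IsRegularLocalRing (Localization.AtPrime P) :=
    fun i hi => HypersurfaceRegular.stub_hypersurfaceRegularOfPderiv k 4 f i P hi
  -- the partial derivatives in characteristic `2`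
  have h2 : (2 : MvPolynomial (Fin 4) k) = 0 := CharTwo.two_eq_zero
  have hd0 : pderiv 0 f = X 2 ^ 2 + X 3 ^ 3 := by
    rw [hf, pderiv_zero_threefold]
    linear_combination (X 0 * X 1 : MvPolynomial (Fin 4) k) * h2
  have hd1 : pderiv 1 f = X 0 ^ 2 + X 2 * X 3 ^ 2 := by
    rw [hf, pderiv_one_threefold]
    linear_combination (X 1 * X 2 : MvPolynomial (Fin 4) k) * h2
  have hd2 : pderiv 2 f = X 1 ^ 2 + X 1 * X 3 ^ 2 := by
    rw [hf, pderiv_two_threefold]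
    linear_combination (X 2 * X 0 : MvPolynomial (Fin 4) k) * h2
  have hd3 : pderiv 3 f = X 0 * X 3 ^ 2 := by
    rw [hf, pderiv_three_threefold]
    linear_combination (X 0 * X 3 ^ 2 + X 1 * X 2 * X 3 : MvPolynomial (Fin 4) k) * h2
  by_cases h3 : (X 3 : MvPolynomial (Fin 4) k) ∈ P₀
  · -- `X₃ ∈ P₀`: one of `∂₀f, ∂₁f, ∂₂f` avoids `P₀`, else `𝔪 ≤ P`
    by_cases hm0 : pderiv 0 f ∈ P₀
    · by_cases hm1 : pderiv 1 f ∈ P₀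
      · by_cases hm2 : pderiv 2 f ∈ P₀
        · exfalso
          refine hP ?_
          have hX2 : (X 2 : MvPolynomial (Fin 4) k) ∈ P₀ := by
            refine hprime.mem_of_pow_mem 2 ?_
            have e : (X 2 ^ 2 : MvPolynomial (Fin 4) k) = pderiv 0 f - X 3 ^ 2 * X 3 := by
              rw [hd0]; ring
            rw [e]
            exact Ideal.sub_mem _ hm0 (P₀.mul_mem_left _ h3)
          have hX0 : (X 0 : MvPolynomial (Fin 4) k) ∈ P₀ := by
            refine hprime.mem_of_pow_mem 2 ?_
            have e : (X 0 ^ 2 : MvPolynomial (Fin 4) k) = pderiv 1 f - X 2 * X 3 ^ 2 := by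
              rw [hd1]; ring
            rw [e]
            exact Ideal.sub_mem _ hm1 (P₀.mul_mem_right _ hX2)
          have hX1 : (X 1 : MvPolynomial (Fin 4) k) ∈ P₀ := by
            refine hprime.mem_of_pow_mem 2 ?_
            have e : (X 1 ^ 2 : MvPolynomial (Fin 4) k) = pderiv 2 f - X 1 * X 3 * X 3 := by
              rw [hd2]; ring
            rw [e]
            exact Ideal.sub_mem _ hm2 (P₀.mul_mem_left _ h3)
          rw [Ideal.span_le, Set.range_subset_iff]
          intro j
          fin_cases j
          exacts [hX0, hX1, hX2, h3]
        · exact J 2 hm2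
      · exact J 1 hm1
    · exact J 0 hm0
  · by_cases h0 : (X 0 : MvPolynomial (Fin 4) k) ∈ P₀
    · -- `X₃ ∉ P₀`, `X₀ ∈ P₀`: `∂₁f ∉ P₀` or `∂₀f ∉ P₀`
      by_cases hm1 : pderiv 1 f ∈ P₀
      · have hX2 : (X 2 : MvPolynomial (Fin 4) k) ∈ P₀ := by
          have e : (X 2 * X 3 ^ 2 : MvPolynomial (Fin 4) k) = pderiv 1 f - X 0 * X 0 := by
            rw [hd1]; ring
          have hm : (X 2 * X 3 ^ 2 : MvPolynomial (Fin 4) k) ∈ P₀ := by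
            rw [e]
            exact Ideal.sub_mem _ hm1 (P₀.mul_mem_left _ h0)
          exact (hprime.mem_or_mem hm).resolve_right fun h => h3 (hprime.mem_of_pow_mem 2 h)
        refine J 0 fun hm0 => h3 (hprime.mem_of_pow_mem 3 ?_)
        have e : (X 3 ^ 3 : MvPolynomial (Fin 4) k) = pderiv 0 f - X 2 * X 2 := by
          rw [hd0]; ring
        rw [e]
        exact Ideal.sub_mem _ hm0 (P₀.mul_mem_left _ hX2)
      · exact J 1 hm1
    · -- `X₀, X₃ ∉ P₀`: `∂₃f = X₀X₃² ∉ P₀`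
      refine J 3 fun hm3 => ?_
      rw [hd3] at hm3
      rcases hprime.mem_or_mem hm3 with h | h
      · exact h0 h
      · exact h3 (hprime.mem_of_pow_mem 2 h)

end Summit.ResolutionOfSingularities.ResolutionOfSingularities.Theorems.FInjectiveMacaulayfication.ThreefoldOffCentreRegular

end
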